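import Literature.MathematicalPhysics.QuantumFieldTheory.Balaban1983to89.B11Eq103H1Complex

/-!
# `Balaban1983to89.B9Eq368ProjectionRemainder` — T. Bałaban, *Propagators for lattice gauge theories in a background field*, Commun. Math.
# Phys. **99** (1985) 389–434 [Balaban1985BackgroundPropagators] p. 403 (after (3.67)) *«These results imply that the operators R(U),
# P(U) = I − R(U) extend analytically to the domain (3.37) and satisfy the same bounds»* with the remainder `P′(A)` of (3.68), and the
# `R`-remainder `P₁(A)` of (3.76) p. 405 entering `V(A)` of (3.82)/(3.84) p. 407: THE REMAINDER OF THE PROJECTION `R = R(U)` ONTO `Δ_U N(Q′(U))`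
# ((3.21) p. 394) UNDER A PERTURBATION OF THE PAIR `(Δ_U, Q′(U))`, AT A FIXED FINITE LATTICE — abstract finite-dimensional Hilbert-space letters
# for the pub-balaban NE9 chain's `B11Eq103H1Complex.projR` / `RLatticeK` / `B9Eq326OperatorAssembly.RofU`

statement-level skeleton of published theorems with citation tags; proofs where landed; nothing here is a claim about the Yang–Mills mass gap

PDF held: `paper:balaban1985-cmp99-background-propagators` (journal page = PDF page + 388), pp. 394, 403, 405–407, 416 read by this seat
(2026-08-22) in the held text.

THE PRINT (verbatim).  p. 394, (3.21): *«R = R(U) is the orthogonal projection onto ℛ = Δ^η_U N(Q′)»*.  p. 403: *«These results imply that the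
operators R(U), P(U) = I − R(U) extend analytically to the domain (3.37) and satisfy the same bounds … Moreover we have [(3.68), bounds of the
remainder P′(A)]. The remainder can be written explicitly in terms of the operators introduced until now by writing the expansions of the operators
determining P(U′U).»*  p. 405, (3.76): *«D_{U′U}R(U′U)D*_{U′U} = DRD* − V₂(A) − P₁(A)»*.  p. 407, (3.84): *«Δ_a(U′U) = Δ_a(U) − V(A)»*.  p. 416
(proof of Thm 3.11): *«by (3.86) we get G_□(e^{iηA}) = G_□(1)(I − V(A)G_□(1))⁻¹. In [4] we have proved that the operator G_□(1) is positive,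
hence by the same reasoning as above we prove positivity of G_□.»*

WHY THIS FILE (cell context).  The pub-balaban NE9 owner's gen-79 files proved [B9] Thm 3.11 AT THE FLAT BACKGROUND for the chain's principal
gauge-fixed operator `D*D + DR(1)D* + aQ(1)*Q(1)` (`B5Eq172FlatCoercivity.exists_coercive_principal_flat`) and typed the SHAPE of its second half
(`exists_coercive_principal_of_near_flat`: coercivity at every `U` whose assembled operator is `δ`-close to the flat one).  The closeness has three
parts (print's `V = V₃ + P₁ + P₂`): the differential letters `D`, `D*`, `D*D` (`B9Eq373DerivativeRemainderL2`), the averaging `Q(U)`, and the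
projection `R(U) = projR (D*_U D_U) (Q′(U))` — an orthogonal projection onto a MOVING subspace `Δ_U N(Q′(U))`.  This file supplies the `R`-part
abstractly: the difference of the orthogonal projections onto `Δ₁N(Q′₁)` and `Δ₂N(Q′₂)` is small when `Δ₂ − Δ₁` and `Q′₂ − Q′₁` are small, given
right inverses of the `Q′_i` and the injectivity modulus of `Δ₁` on `N(Q′₁)`.

WHAT IS PROVED (sorry-free; no `Prop` placeholder; no inequality of the paper asserted).
* §1 `norm_starProjection_of_mem_orthogonal_le`, **`norm_starProjection_sub_starProjection_le`** (two subspaces `K`, `K′` with one-sided relative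
  gaps `θ`, `θ′` have `‖P_K y − P_{K′} y‖ ≤ (θ + θ′)‖y‖`), `norm_sub_starProjection_le_of_mem` (a witness bounds the one-sided gap).
* §2 `projR_apply` (unfolding), `gap_map_ker_le` (the gap `Δ₁N(Q′₁) → Δ₂N(Q′₂)` is `≤ (εΔ + Mρ)/μ`), `modulus_perturbed` (the perturbed modulus
  `ν = μ(1 − ρ) − (εΔ + Mρ)`), **`norm_projR_sub_projR_le`**: `‖R₁y − R₂y‖ ≤ (2(εΔ + Mρ)/ν)‖y‖`.
* §3 `norm_projR_le` (`‖Ry‖ ≤ ‖y‖`), **`exists_modulus_of_ker_inj`** (injective on `N(Q′)` ⇒ a modulus `μ > 0`, compact unit sphere).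
MODEL / DECLARED READINGS.  (M1) `E` a finite-dimensional `𝕜`-Hilbert space (gauge parameters), `F′` any `𝕜`-module (coarse gauge parameters),
`Δ_i : E →ₗ E`, `Q′_i : E →ₗ F′`, right inverses `S_i`; the smallness letters `εΔ` (`‖(Δ₂ − Δ₁)λ‖ ≤ εΔ‖λ‖`), `ρ` (`‖S_i(Q′₂ − Q′₁)λ‖ ≤ ρ‖λ‖`), a
common bound `M`.  (M2) MECHANISM [folklore] (gap ∕ aperture of subspaces, cf. Kato, *Perturbation theory*, IV §2) — NOT print's route (the
representation of `R` through `G′ = (Δ^η_U restricted)⁻¹` and `(Q′G′²Q′*)⁻¹`, (3.24)–(3.25), expanded by (3.64)–(3.67)); the constants are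
crude.  (M3) NOT HERE: any uniformity in the lattice (print's kernel bounds (3.68), (3.77) with exponential decay), analyticity in `A`.
HONEST SCOPE.  Elementary finite-dimensional perturbation theory for the chain's OWN projection letter; reproduces the MECHANISM of p. 403 / p. 416
at a fixed lattice; NOT summit progress (cell pub-balaban: NE9 NOT PRINTED / NOT PROVED; spine PROVED 0/9).  Filed by the pub-balaban NE9
BINDER-row owner lineage `b2b-balaban-t4-ne9-p1` (gen 80); NEW file importing `B11Eq103H1Complex` only; nothing modified.  Net new unproved facts: 0.
-/

noncomputable section

open scoped InnerProductSpace ComplexConjugate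

namespace Literature.MathematicalPhysics.QuantumFieldTheory.Balaban1983to89.B9Eq368ProjectionRemainder

open B11Eq103H1Complex (projR)

/-! ## §1 Two subspaces with small one-sided gaps have close orthogonal projections -/

section Gap

variable {𝕜 : Type*} [RCLike 𝕜] {E : Type*} [NormedAddCommGroup E] [InnerProductSpace 𝕜 E]

/-- For an orthogonal projection `P′` and `w ⊥ K`: `‖P′w‖ ≤ θ′‖w‖` as soon as every element of `K′` is within relative distance `θ′` of `K`
(`‖P′w‖² = re⟪P′w, w⟫ = re⟪P′w − P(P′w), w⟫ ≤ θ′‖P′w‖‖w‖`). [folklore] [cite: Balaban1985BackgroundPropagators, (3.21) p.394, (3.68) p.403] -/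
theorem norm_starProjection_of_mem_orthogonal_le (K K' : Submodule 𝕜 E) [K.HasOrthogonalProjection] [K'.HasOrthogonalProjection]
    {θ' : ℝ} (hθ' : 0 ≤ θ') (hK' : ∀ e' ∈ K', ‖e' - K.starProjection e'‖ ≤ θ' * ‖e'‖) {w : E} (hw : w ∈ Kᗮ) :
    ‖K'.starProjection w‖ ≤ θ' * ‖w‖ := by
  set z := K'.starProjection w with hz
  have hzK' : z ∈ K' := K'.starProjection_apply_mem w
  -- `‖z‖² = re⟪z, w⟫`
  have h1 : ‖z‖ ^ 2 = RCLike.re ⟪z, w⟫_𝕜 := by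
    rw [hz, Submodule.re_inner_starProjection_eq_normSq, Submodule.starProjection_apply, Submodule.coe_norm]
  -- `⟪z, w⟫ = ⟪z − Pz, w⟫` since `Pz ∈ K`, `w ∈ Kᗮ`
  have h2 : ⟪z, w⟫_𝕜 = ⟪z - K.starProjection z, w⟫_𝕜 := by
    rw [inner_sub_left, K.inner_right_of_mem_orthogonal (K.starProjection_apply_mem z) hw, sub_zero]
  have h3 : ‖z‖ ^ 2 ≤ θ' * ‖z‖ * ‖w‖ := by
    rw [h1, h2]
    calc RCLike.re ⟪z - K.starProjection z, w⟫_𝕜 ≤ ‖z - K.starProjection z‖ * ‖w‖ := re_inner_le_norm _ _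
      _ ≤ θ' * ‖z‖ * ‖w‖ := mul_le_mul_of_nonneg_right (hK' z hzK') (norm_nonneg _)
  rcases eq_or_lt_of_le (norm_nonneg z) with hz0 | hzpos
  · rw [← hz0]; positivity
  · have : ‖z‖ * ‖z‖ ≤ (θ' * ‖w‖) * ‖z‖ := by nlinarith
    exact le_of_mul_le_mul_right this hzpos

/-- **TWO SUBSPACES WITH SMALL ONE-SIDED GAPS HAVE CLOSE ORTHOGONAL PROJECTIONS**: if every `e ∈ K` is within `θ‖e‖` of `K′` and every
`e′ ∈ K′` within `θ′‖e′‖` of `K`, then `‖P_K y − P_{K′} y‖ ≤ (θ + θ′)‖y‖` — from `P_K y − P_{K′} y = (e − P_{K′}e) − P_{K′}(y − e)`,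
`e = P_K y`, and the previous lemma for `w = y − e ⊥ K`.  (The gap / «aperture» of two subspaces, cf. Kato IV §2; crude constant.) [folklore]
[cite: Balaban1985BackgroundPropagators, (3.21) p.394, (3.68) p.403] -/
theorem norm_starProjection_sub_starProjection_le (K K' : Submodule 𝕜 E) [K.HasOrthogonalProjection] [K'.HasOrthogonalProjection]
    {θ θ' : ℝ} (hθ : 0 ≤ θ) (hθ' : 0 ≤ θ')
    (hK : ∀ e ∈ K, ‖e - K'.starProjection e‖ ≤ θ * ‖e‖) (hK' : ∀ e' ∈ K', ‖e' - K.starProjection e'‖ ≤ θ' * ‖e'‖) (y : E) :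
    ‖K.starProjection y - K'.starProjection y‖ ≤ (θ + θ') * ‖y‖ := by
  set e := K.starProjection y with he
  have hw : y - e ∈ Kᗮ := K.sub_starProjection_mem_orthogonal y
  have hsplit : K.starProjection y - K'.starProjection y = (e - K'.starProjection e) - K'.starProjection (y - e) := by
    rw [map_sub]; abel
  have hey : ‖e‖ ≤ ‖y‖ := K.norm_starProjection_apply_le y
  have hwy : ‖y - e‖ ≤ ‖y‖ := by
    rw [he, ← Submodule.starProjection_orthogonal_val]
    exact Kᗮ.norm_starProjection_apply_le y
  rw [hsplit]
  calc ‖(e - K'.starProjection e) - K'.starProjection (y - e)‖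
      ≤ ‖e - K'.starProjection e‖ + ‖K'.starProjection (y - e)‖ := norm_sub_le _ _
    _ ≤ θ * ‖e‖ + θ' * ‖y - e‖ :=
        add_le_add (hK e (K.starProjection_apply_mem y)) (norm_starProjection_of_mem_orthogonal_le K K' hθ' hK' hw)
    _ ≤ θ * ‖y‖ + θ' * ‖y‖ := add_le_add (mul_le_mul_of_nonneg_left hey hθ) (mul_le_mul_of_nonneg_left hwy hθ')
    _ = (θ + θ') * ‖y‖ := by ring

/-- One-sided gap from a witness: if `m ∈ K′` then `‖e − P_{K′} e‖ ≤ ‖e − m‖` (the orthogonal projection minimises the distance). [folklore]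
[cite: Balaban1985BackgroundPropagators, (3.21) p.394] -/
theorem norm_sub_starProjection_le_of_mem (K' : Submodule 𝕜 E) [K'.HasOrthogonalProjection] (e : E) {m : E} (hm : m ∈ K') :
    ‖e - K'.starProjection e‖ ≤ ‖e - m‖ := by
  rw [Submodule.starProjection_minimal]
  exact ciInf_le ⟨0, Set.forall_mem_range.2 fun _ => norm_nonneg _⟩ (⟨m, hm⟩ : K')

end Gap

/-! ## §2 The ranges `Δ N(Q′)`: the remainder of `R` under a perturbation of `(Δ, Q′)` -/

section Ranges

variable {𝕜 : Type*} [RCLike 𝕜] {E : Type*} [NormedAddCommGroup E] [InnerProductSpace 𝕜 E] [FiniteDimensional 𝕜 E]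
  {F' : Type*} [AddCommGroup F'] [Module 𝕜 F']

/-- `projR Δs Q′` IS the orthogonal projection onto `Δs N(Q′)` (unfolding, with the finite-dimensional completeness instance in scope).
[cite: Balaban1985BackgroundPropagators, (3.21) p.394] -/
theorem projR_apply (Δs : E →ₗ[𝕜] E) (Q' : E →ₗ[𝕜] F') (y : E) :
    haveI : CompleteSpace ((LinearMap.ker Q').map Δs) := FiniteDimensional.complete 𝕜 _
    projR Δs Q' y = ((LinearMap.ker Q').map Δs).starProjection y := rfl

/-- **ONE-SIDED GAP `Δ₁N(Q′₁) → Δ₂N(Q′₂)`**: with a right inverse `S₂` of `Q′₂`, the injectivity modulus `μ` of `Δ₁` on `N(Q′₁)`, a bound `M` of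
`Δ₂` and the smallness letters `εΔ` (of `Δ₂ − Δ₁`) and `ρ` (of `S₂(Q′₂ − Q′₁)`): every `e = Δ₁λ`, `Q′₁λ = 0`, is within `((εΔ + Mρ)/μ)‖e‖` of
`Δ₂N(Q′₂)` — witness `Δ₂(λ − S₂(Q′₂ − Q′₁)λ)`. [folklore] [cite: Balaban1985BackgroundPropagators, (3.68) p.403, (3.76) p.405] -/
theorem gap_map_ker_le (Δ₁ Δ₂ : E →ₗ[𝕜] E) (Q₁ Q₂ : E →ₗ[𝕜] F') (S₂ : F' →ₗ[𝕜] E) (hS₂ : ∀ f, Q₂ (S₂ f) = f)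
    {μ M εΔ ρ : ℝ} (hμ : 0 < μ) (hM : 0 ≤ M) (hε : 0 ≤ εΔ) (hρ0 : 0 ≤ ρ)
    (hinj : ∀ l : E, Q₁ l = 0 → μ * ‖l‖ ≤ ‖Δ₁ l‖) (hM₂ : ∀ l : E, ‖Δ₂ l‖ ≤ M * ‖l‖)
    (hΔ : ∀ l : E, ‖Δ₂ l - Δ₁ l‖ ≤ εΔ * ‖l‖) (hρ : ∀ l : E, ‖S₂ (Q₂ l - Q₁ l)‖ ≤ ρ * ‖l‖)
    (e : E) (he : e ∈ (LinearMap.ker Q₁).map Δ₁) :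
    haveI : CompleteSpace ((LinearMap.ker Q₂).map Δ₂) := FiniteDimensional.complete 𝕜 _
    ‖e - ((LinearMap.ker Q₂).map Δ₂).starProjection e‖ ≤ (εΔ + M * ρ) / μ * ‖e‖ := by
  haveI : CompleteSpace ((LinearMap.ker Q₂).map Δ₂) := FiniteDimensional.complete 𝕜 _
  obtain ⟨l, hl, rfl⟩ := Submodule.mem_map.1 he
  have hl0 : Q₁ l = 0 := LinearMap.mem_ker.1 hl
  -- the witness `Δ₂(l − S₂(Q′₂ − Q′₁)l)`, with `l − S₂(Q′₂ − Q′₁)l ∈ N(Q′₂)`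
  have hl'ker : l - S₂ (Q₂ l - Q₁ l) ∈ LinearMap.ker Q₂ := by
    rw [LinearMap.mem_ker, map_sub, hS₂, hl0, sub_zero, sub_self]
  have hmem : Δ₂ (l - S₂ (Q₂ l - Q₁ l)) ∈ (LinearMap.ker Q₂).map Δ₂ := Submodule.mem_map_of_mem hl'ker
  have hdist : ‖Δ₁ l - Δ₂ (l - S₂ (Q₂ l - Q₁ l))‖ ≤ (εΔ + M * ρ) * ‖l‖ := by
    have h1 : Δ₁ l - Δ₂ (l - S₂ (Q₂ l - Q₁ l)) = (Δ₁ l - Δ₂ l) + Δ₂ (S₂ (Q₂ l - Q₁ l)) := by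
      rw [map_sub]; abel
    rw [h1]
    have h2 : ‖Δ₁ l - Δ₂ l‖ ≤ εΔ * ‖l‖ := by rw [norm_sub_rev]; exact hΔ l
    have h3 : ‖Δ₂ (S₂ (Q₂ l - Q₁ l))‖ ≤ M * (ρ * ‖l‖) := (hM₂ _).trans (mul_le_mul_of_nonneg_left (hρ l) hM)
    calc ‖(Δ₁ l - Δ₂ l) + Δ₂ (S₂ (Q₂ l - Q₁ l))‖ ≤ ‖Δ₁ l - Δ₂ l‖ + ‖Δ₂ (S₂ (Q₂ l - Q₁ l))‖ := norm_add_le _ _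
      _ ≤ εΔ * ‖l‖ + M * (ρ * ‖l‖) := add_le_add h2 h3
      _ = (εΔ + M * ρ) * ‖l‖ := by ring
  have hle : ‖l‖ ≤ ‖Δ₁ l‖ / μ := by
    rw [le_div_iff₀ hμ, mul_comm]; exact hinj l hl0
  calc ‖Δ₁ l - ((LinearMap.ker Q₂).map Δ₂).starProjection (Δ₁ l)‖ ≤ ‖Δ₁ l - Δ₂ (l - S₂ (Q₂ l - Q₁ l))‖ :=
        norm_sub_starProjection_le_of_mem _ _ hmem
    _ ≤ (εΔ + M * ρ) * ‖l‖ := hdist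
    _ ≤ (εΔ + M * ρ) * (‖Δ₁ l‖ / μ) := mul_le_mul_of_nonneg_left hle (by positivity)
    _ = (εΔ + M * ρ) / μ * ‖Δ₁ l‖ := by ring

omit [FiniteDimensional 𝕜 E] in
/-- **THE PERTURBED INJECTIVITY MODULUS**: under the same letters plus a right inverse `S₁` of `Q′₁` with `‖S₁(Q′₁ − Q′₂)κ‖ ≤ ρ‖κ‖` and a bound
`M` of `Δ₁`, `Δ₂` is injective on `N(Q′₂)` with modulus `ν = μ(1 − ρ) − (εΔ + Mρ)` (when positive): `ν‖κ‖ ≤ ‖Δ₂κ‖` for `Q′₂κ = 0` — via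
`κ₁ = κ − S₁(Q′₁ − Q′₂)κ ∈ N(Q′₁)`. [folklore] [cite: Balaban1985BackgroundPropagators, (3.68) p.403] -/
theorem modulus_perturbed (Δ₁ Δ₂ : E →ₗ[𝕜] E) (Q₁ Q₂ : E →ₗ[𝕜] F') (S₁ : F' →ₗ[𝕜] E) (hS₁ : ∀ f, Q₁ (S₁ f) = f)
    {μ M εΔ ρ : ℝ} (hμ : 0 < μ) (hM : 0 ≤ M)
    (hinj : ∀ l : E, Q₁ l = 0 → μ * ‖l‖ ≤ ‖Δ₁ l‖) (hM₁ : ∀ l : E, ‖Δ₁ l‖ ≤ M * ‖l‖)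
    (hΔ : ∀ l : E, ‖Δ₂ l - Δ₁ l‖ ≤ εΔ * ‖l‖) (hρ : ∀ l : E, ‖S₁ (Q₁ l - Q₂ l)‖ ≤ ρ * ‖l‖)
    (κ : E) (hκ : Q₂ κ = 0) : (μ * (1 - ρ) - (εΔ + M * ρ)) * ‖κ‖ ≤ ‖Δ₂ κ‖ := by
  have hκ₁ker : Q₁ (κ - S₁ (Q₁ κ - Q₂ κ)) = 0 := by rw [map_sub, hS₁, hκ, sub_zero, sub_self]
  have hκ₁ge : (1 - ρ) * ‖κ‖ ≤ ‖κ - S₁ (Q₁ κ - Q₂ κ)‖ := by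
    have h := norm_sub_norm_le κ (S₁ (Q₁ κ - Q₂ κ))
    have h' := hρ κ
    linarith
  have h1 : μ * ‖κ - S₁ (Q₁ κ - Q₂ κ)‖ ≤ ‖Δ₁ (κ - S₁ (Q₁ κ - Q₂ κ))‖ := hinj _ hκ₁ker
  have h2 : ‖Δ₁ (κ - S₁ (Q₁ κ - Q₂ κ))‖ ≤ ‖Δ₂ κ‖ + (εΔ + M * ρ) * ‖κ‖ := by
    have hsplit : Δ₁ (κ - S₁ (Q₁ κ - Q₂ κ)) = Δ₂ κ - (Δ₂ κ - Δ₁ κ) - Δ₁ (S₁ (Q₁ κ - Q₂ κ)) := by rw [map_sub]; abel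
    rw [hsplit]
    have h3 : ‖Δ₁ (S₁ (Q₁ κ - Q₂ κ))‖ ≤ M * (ρ * ‖κ‖) := (hM₁ _).trans (mul_le_mul_of_nonneg_left (hρ κ) hM)
    have h4 : ‖Δ₂ κ - (Δ₂ κ - Δ₁ κ)‖ ≤ ‖Δ₂ κ‖ + εΔ * ‖κ‖ := (norm_sub_le _ _).trans (by linarith [hΔ κ])
    calc ‖Δ₂ κ - (Δ₂ κ - Δ₁ κ) - Δ₁ (S₁ (Q₁ κ - Q₂ κ))‖
        ≤ ‖Δ₂ κ - (Δ₂ κ - Δ₁ κ)‖ + ‖Δ₁ (S₁ (Q₁ κ - Q₂ κ))‖ := norm_sub_le _ _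
      _ ≤ (‖Δ₂ κ‖ + εΔ * ‖κ‖) + M * (ρ * ‖κ‖) := add_le_add h4 h3
      _ = ‖Δ₂ κ‖ + (εΔ + M * ρ) * ‖κ‖ := by ring
  have h3 : μ * ((1 - ρ) * ‖κ‖) ≤ μ * ‖κ - S₁ (Q₁ κ - Q₂ κ)‖ := mul_le_mul_of_nonneg_left hκ₁ge hμ.le
  nlinarith

/-- **THE REMAINDER OF `R` UNDER A PERTURBATION OF `(Δ, Q′)`** ([B9] p. 403: *«the operators R(U), P(U) = I − R(U) extend … and satisfy the same
bounds»*, the remainder `P′(A)` of (3.68), here at a FIXED finite lattice): for `R_i = projR Δ_i Q′_i` = the orthogonal projection onto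
`Δ_i N(Q′_i)` (`i = 1, 2`), right inverses `S_i` of `Q′_i`, the injectivity modulus `μ > 0` of `Δ₁` on `N(Q′₁)`, a common bound `M` of `Δ₁`, `Δ₂`,
and the smallness letters `‖(Δ₂ − Δ₁)λ‖ ≤ εΔ‖λ‖`, `‖S₂(Q′₂ − Q′₁)λ‖ ≤ ρ‖λ‖`, `‖S₁(Q′₁ − Q′₂)λ‖ ≤ ρ‖λ‖` with `ν := μ(1 − ρ) − (εΔ + Mρ) > 0`:
`‖R₁y − R₂y‖ ≤ (2(εΔ + Mρ)/ν)·‖y‖`.  MECHANISM [folklore]: two one-sided gaps (§1) — NOT print's representation of `R` through `G′` and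
`(Q′G′²Q′*)⁻¹` ((3.24)–(3.25), (3.65)–(3.67)); no uniformity in the lattice. [cite: Balaban1985BackgroundPropagators, (3.21) p.394, (3.68) p.403, (3.76) p.405] -/
theorem norm_projR_sub_projR_le (Δ₁ Δ₂ : E →ₗ[𝕜] E) (Q₁ Q₂ : E →ₗ[𝕜] F') (S₁ S₂ : F' →ₗ[𝕜] E)
    (hS₁ : ∀ f, Q₁ (S₁ f) = f) (hS₂ : ∀ f, Q₂ (S₂ f) = f)
    {μ M εΔ ρ : ℝ} (hμ : 0 < μ) (hM : 0 ≤ M) (hε : 0 ≤ εΔ) (hρ0 : 0 ≤ ρ)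
    (hinj : ∀ l : E, Q₁ l = 0 → μ * ‖l‖ ≤ ‖Δ₁ l‖) (hM₁ : ∀ l : E, ‖Δ₁ l‖ ≤ M * ‖l‖) (hM₂ : ∀ l : E, ‖Δ₂ l‖ ≤ M * ‖l‖)
    (hΔ : ∀ l : E, ‖Δ₂ l - Δ₁ l‖ ≤ εΔ * ‖l‖)
    (hρ₂ : ∀ l : E, ‖S₂ (Q₂ l - Q₁ l)‖ ≤ ρ * ‖l‖) (hρ₁ : ∀ l : E, ‖S₁ (Q₁ l - Q₂ l)‖ ≤ ρ * ‖l‖)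
    (hν : 0 < μ * (1 - ρ) - (εΔ + M * ρ)) (y : E) :
    ‖projR Δ₁ Q₁ y - projR Δ₂ Q₂ y‖ ≤ 2 * (εΔ + M * ρ) / (μ * (1 - ρ) - (εΔ + M * ρ)) * ‖y‖ := by
  haveI i1 : CompleteSpace ((LinearMap.ker Q₁).map Δ₁) := FiniteDimensional.complete 𝕜 _
  haveI i2 : CompleteSpace ((LinearMap.ker Q₂).map Δ₂) := FiniteDimensional.complete 𝕜 _
  have hνμ : μ * (1 - ρ) - (εΔ + M * ρ) ≤ μ := by
    have : 0 ≤ μ * ρ := mul_nonneg hμ.le hρ0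
    have : 0 ≤ M * ρ := mul_nonneg hM hρ0
    linarith
  -- one-sided gap K₁ → K₂ with `θ = (εΔ + Mρ)/μ ≤ (εΔ + Mρ)/ν`
  have hθ : ∀ e ∈ (LinearMap.ker Q₁).map Δ₁, ‖e - ((LinearMap.ker Q₂).map Δ₂).starProjection e‖ ≤
      (εΔ + M * ρ) / (μ * (1 - ρ) - (εΔ + M * ρ)) * ‖e‖ :=
    fun e he => (gap_map_ker_le Δ₁ Δ₂ Q₁ Q₂ S₂ hS₂ hμ hM hε hρ0 hinj hM₂ hΔ hρ₂ e he).trans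
      (mul_le_mul_of_nonneg_right (div_le_div_of_nonneg_left (by positivity) hν hνμ) (norm_nonneg _))
  -- one-sided gap K₂ → K₁ with the perturbed modulus `ν` (the letters read backwards: `εΔ` symmetric, `ρ` via `S₁`)
  have hinj₂ : ∀ l : E, Q₂ l = 0 → (μ * (1 - ρ) - (εΔ + M * ρ)) * ‖l‖ ≤ ‖Δ₂ l‖ :=
    fun l hl => modulus_perturbed Δ₁ Δ₂ Q₁ Q₂ S₁ hS₁ hμ hM hinj hM₁ hΔ hρ₁ l hl
  have hΔ' : ∀ l : E, ‖Δ₁ l - Δ₂ l‖ ≤ εΔ * ‖l‖ := fun l => by rw [norm_sub_rev]; exact hΔ l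
  have hθ' : ∀ e' ∈ (LinearMap.ker Q₂).map Δ₂, ‖e' - ((LinearMap.ker Q₁).map Δ₁).starProjection e'‖ ≤
      (εΔ + M * ρ) / (μ * (1 - ρ) - (εΔ + M * ρ)) * ‖e'‖ :=
    fun e' he' => gap_map_ker_le Δ₂ Δ₁ Q₂ Q₁ S₁ hS₁ hν hM hε hρ0 hinj₂ hM₁ hΔ' hρ₁ e' he'
  have hmain := norm_starProjection_sub_starProjection_le ((LinearMap.ker Q₁).map Δ₁) ((LinearMap.ker Q₂).map Δ₂)
    (θ := (εΔ + M * ρ) / (μ * (1 - ρ) - (εΔ + M * ρ))) (θ' := (εΔ + M * ρ) / (μ * (1 - ρ) - (εΔ + M * ρ)))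
    (by positivity) (by positivity) hθ hθ' y
  rw [projR_apply, projR_apply]
  calc _ ≤ ((εΔ + M * ρ) / (μ * (1 - ρ) - (εΔ + M * ρ)) + (εΔ + M * ρ) / (μ * (1 - ρ) - (εΔ + M * ρ))) * ‖y‖ := hmain
    _ = 2 * (εΔ + M * ρ) / (μ * (1 - ρ) - (εΔ + M * ρ)) * ‖y‖ := by ring

end Ranges

/-! ## §3 Two more letters of the junction: `‖Ry‖ ≤ ‖y‖`, and the injectivity modulus on `N(Q′)` EXISTS at a finite lattice -/

section Modulus

variable {𝕜 : Type*} [RCLike 𝕜] {E : Type*} [NormedAddCommGroup E] [InnerProductSpace 𝕜 E] [FiniteDimensional 𝕜 E]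
  {F' : Type*} [AddCommGroup F'] [Module 𝕜 F']

/-- `‖R y‖ ≤ ‖y‖` (orthogonal projection). [cite: Balaban1985BackgroundPropagators, (3.21) p.394] -/
theorem norm_projR_le (Δs : E →ₗ[𝕜] E) (Q' : E →ₗ[𝕜] F') (y : E) : ‖projR Δs Q' y‖ ≤ ‖y‖ := by
  rw [projR_apply]; exact Submodule.norm_starProjection_apply_le _ y

/-- **THE INJECTIVITY MODULUS EXISTS**: on a finite-dimensional space, if `Δ` is injective on `N(Q′)` then `μ‖λ‖ ≤ ‖Δλ‖` on `N(Q′)` for some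
`μ > 0` (minimum of `‖Δ·‖` on the compact unit sphere of `N(Q′)`) — a finite-lattice number, no uniformity. [folklore]
[cite: Balaban1985BackgroundPropagators, (3.21)–(3.23) p.394] -/
theorem exists_modulus_of_ker_inj (Δ : E →ₗ[𝕜] E) (Q' : E →ₗ[𝕜] F') (hinj : ∀ l : E, Q' l = 0 → Δ l = 0 → l = 0) :
    ∃ μ : ℝ, 0 < μ ∧ ∀ l : E, Q' l = 0 → μ * ‖l‖ ≤ ‖Δ l‖ := by
  haveI : ProperSpace E := FiniteDimensional.proper_rclike 𝕜 E
  have hcont : Continuous fun x : E => ‖Δ x‖ := continuous_norm.comp Δ.continuous_of_finiteDimensional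
  -- the compact set: unit sphere ∩ `N(Q′)`
  have hclosed : IsClosed (LinearMap.ker Q' : Set E) := (LinearMap.ker Q').closed_of_finiteDimensional
  have hcpt : IsCompact (Metric.sphere (0 : E) 1 ∩ (LinearMap.ker Q' : Set E)) := (isCompact_sphere 0 1).inter_right hclosed
  have hunit : ∀ l : E, Q' l = 0 → l ≠ 0 → ((‖l‖⁻¹ : ℝ) : 𝕜) • l ∈ Metric.sphere (0 : E) 1 ∩ (LinearMap.ker Q' : Set E) := fun l hl hl0 => by
    have hln : 0 < ‖l‖ := norm_pos_iff.2 hl0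
    refine ⟨?_, ?_⟩
    · rw [mem_sphere_zero_iff_norm, norm_smul, RCLike.norm_ofReal, abs_of_pos (inv_pos.2 hln), inv_mul_cancel₀ hln.ne']
    · exact (LinearMap.ker Q').smul_mem _ (LinearMap.mem_ker.2 hl)
  by_cases hne : (Metric.sphere (0 : E) 1 ∩ (LinearMap.ker Q' : Set E)).Nonempty
  · obtain ⟨u, hu, hmin⟩ := hcpt.exists_isMinOn hne hcont.continuousOn
    have hu1 : ‖u‖ = 1 := mem_sphere_zero_iff_norm.1 hu.1
    have hu0 : u ≠ 0 := by rw [← norm_ne_zero_iff, hu1]; exact one_ne_zero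
    have huQ : Q' u = 0 := LinearMap.mem_ker.1 hu.2
    have hμ : 0 < ‖Δ u‖ := by
      rw [norm_pos_iff]
      exact fun h => hu0 (hinj u huQ h)
    refine ⟨‖Δ u‖, hμ, fun l hl => ?_⟩
    by_cases hl0 : l = 0
    · rw [hl0, norm_zero, mul_zero]; exact norm_nonneg _
    · have hln : 0 < ‖l‖ := norm_pos_iff.2 hl0
      have hle : ‖Δ u‖ ≤ ‖Δ (((‖l‖⁻¹ : ℝ) : 𝕜) • l)‖ := hmin (hunit l hl hl0)
      rw [map_smul, norm_smul, RCLike.norm_ofReal, abs_of_pos (inv_pos.2 hln)] at hle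
      rwa [← div_eq_inv_mul, le_div_iff₀ hln] at hle
  · refine ⟨1, one_pos, fun l hl => ?_⟩
    by_cases hl0 : l = 0
    · rw [hl0, norm_zero, mul_zero]; exact norm_nonneg _
    · exact absurd ⟨_, hunit l hl hl0⟩ hne

end Modulus


end Literature.MathematicalPhysics.QuantumFieldTheory.Balaban1983to89.B9Eq368ProjectionRemainder

end
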